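import Literature.Topology.PlaneTopology.PolygonUmlaufsatz

/-!
# Signed Hopf Umlaufsatz for simple closed polygons at a lowest vertex
(helper for stub `stub_kirchhoff` of line `finitary-green-pairing`, crux `CoherentMorera`, stmt-CriticalPhenomena-11388)

`Literature.Topology.PlaneTopology.IsSimplePolygon.sum_extAngle_eq_of_lowest` proves that the exterior
angles of a simple closed polygon sum to `±2π`.  Hopf's proof in fact pins the SIGN at a lowest vertex:
the total turning is `2(θ₀ + B − A)` with `θ₀` the exterior angle at the lowest vertex `z 0` and
`A = arg (-i (z 1 - z 0))`, `B = arg (i (z 0 - z (n-1)))` in `[-π/2, π/2]`, so the total turning has the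
sign of `θ₀` whenever `θ₀ ≠ 0`: a polygon turning LEFT at a lowest vertex is positively oriented.  This is
the orientation half of Hopf's Satz I (H. Hopf, Compositio Math. 2 (1935)), which the percolation pairing
behind Duminil-Copin's Prop. 4 at spin `1/3` needs (the spin-`1/2` weights of Smirnov's Lemma 4.5 only see
the turning modulo `8` quarter turns).
-/

noncomputable section

namespace Summit.CriticalPhenomena.CardyFormulaZ2.Cruxes.CoherentMorera.FinitaryGreenPairing

open Complex Set Literature.Topology.PlaneTopology
open scoped Real

variable {z : ℤ → ℂ} {n : ℕ}

/-- **Hopf's identity at a lowest vertex**: the total turning of a simple closed polygon whose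
vertex `z 0` is lowest equals `2 (θ₀ + B − A)`, `θ₀ = extAngle z 0`, `A = arg (-i (z 1 - z 0))`,
`B = arg (i (z 0 - z (n-1)))` (the chain identity of the secant logarithm, imaginary parts). -/
theorem sum_extAngle_eq_two_mul (h : IsSimplePolygon z n) (hlow : ∀ i, (z 0).im ≤ (z i).im) :
    ∑ i ∈ Finset.range n, extAngle z i =
      2 * (extAngle z 0 + arg (I * (z 0 - z (n - 1))) - arg (-I * (z 1 - z 0))) := by
  -- the chain identity: the increments of the global logarithm along the closed chain cancel
  obtain ⟨L, hL, hLe⟩ := h.hasLogOn_secantMap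
  obtain ⟨mA, mB, mC, mD⟩ := h.mapsTo_hopf
  have eA := logInc_comp_of_log hL hLe (γ := hopfA n) (by unfold hopfA; fun_prop) mA
  have eB := logInc_comp_of_log hL hLe (γ := hopfB n) (by unfold hopfB; fun_prop) mB
  have eC := logInc_comp_of_log hL hLe (γ := hopfC n) (by unfold hopfC; fun_prop) mC
  have eD := logInc_comp_of_log hL hLe (γ := hopfD n) (by unfold hopfD; fun_prop) mD
  have chain : logInc (secantMap z ∘ hopfA n) + logInc (secantMap z ∘ hopfB n) +
      logInc (secantMap z ∘ hopfC n) + logInc (secantMap z ∘ hopfD n) = 0 := by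
    rw [eA, eB, eC, eD]
    have e1 : hopfA n 1 = hopfB n 0 := by rw [hopfA, hopfB, Prod.mk.injEq]; exact ⟨by ring, by ring⟩
    have e2 : hopfB n 1 = hopfC n 0 := by rw [hopfB, hopfC, Prod.mk.injEq]; exact ⟨by ring, by ring⟩
    have e3 : hopfC n 1 = hopfD n 0 := by rw [hopfC, hopfD, Prod.mk.injEq]; exact ⟨by ring, by ring⟩
    have e4 : hopfD n 1 = hopfA n 0 := by rw [hopfD, hopfA, Prod.mk.injEq]; exact ⟨by ring, by ring⟩
    rw [e1, e2, e3, e4]; ring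
  rw [logInc_hopfA h hlow, logInc_hopfB h, logInc_hopfC h hlow, logInc_hopfD h] at chain
  have him := congrArg Complex.im chain
  simp only [add_im, sub_im, neg_im, log_im, zero_im, Complex.im_sum] at him
  -- the target sum, split off the angle at `z 0`
  have hsum : ∑ i ∈ Finset.range n, extAngle z i =
      arg ((z 1 - z 0) / (z 0 - z (n - 1))) +
        ∑ j ∈ Finset.range (n - 1), arg ((z (j + 2) - z (j + 1)) / (z (j + 1) - z j)) := by
    have hsplit : ∑ i ∈ Finset.range n, extAngle z i =
        ∑ j ∈ Finset.range (n - 1), extAngle z ((j + 1 : ℕ) : ℤ) + extAngle z ((0 : ℕ) : ℤ) := by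
      conv_lhs => rw [show n = n - 1 + 1 from (Nat.sub_add_cancel h.pos).symm]
      exact Finset.sum_range_succ' (fun i : ℕ => extAngle z i) (n - 1)
    rw [hsplit, add_comm]
    congr 1
    · rw [Nat.cast_zero, extAngle, zero_add, zero_sub, h.vertex_neg_one]
    · exact Finset.sum_congr rfl fun j _ => extAngle_natCast_succ z j
  have h0 : extAngle z 0 = arg ((z 1 - z 0) / (z 0 - z (n - 1))) := by
    rw [extAngle, zero_add, zero_sub, h.vertex_neg_one]
  rw [hsum, h0]
  linarith

/-- The two extreme secant directions at a lowest vertex point into the closed upper half-plane: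
`|arg (-i (z 1 - z 0))| ≤ π/2`. -/
theorem abs_arg_negI_mul_le (hlow : ∀ i, (z 0).im ≤ (z i).im) : |arg (-I * (z 1 - z 0))| ≤ π / 2 := by
  rw [abs_arg_le_pi_div_two_iff]
  have : (-I * (z 1 - z 0)).re = (z 1).im - (z 0).im := by simp
  rw [this]; linarith [hlow 1]

/-- `|arg (i (z 0 - z (n-1)))| ≤ π/2` at a lowest vertex. -/
theorem abs_arg_I_mul_le (hlow : ∀ i, (z 0).im ≤ (z i).im) : |arg (I * (z 0 - z (n - 1)))| ≤ π / 2 := by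
  rw [abs_arg_le_pi_div_two_iff]
  have : (I * (z 0 - z (n - 1))).re = (z (n - 1)).im - (z 0).im := by simp
  rw [this]; linarith [hlow (n - 1)]

/-- **Signed Umlaufsatz, left turn.** A simple closed polygon turning left (`extAngle z 0 > 0`) at
a lowest vertex `z 0` has total turning `+2π`. -/
theorem sum_extAngle_eq_two_pi_of_lowest_of_pos (h : IsSimplePolygon z n)
    (hlow : ∀ i, (z 0).im ≤ (z i).im) (hpos : 0 < extAngle z 0) :
    ∑ i ∈ Finset.range n, extAngle z i = 2 * π := by
  rcases h.sum_extAngle_eq_of_lowest hlow with hT | hT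
  · exact hT
  · exfalso
    have hid := sum_extAngle_eq_two_mul h hlow
    obtain ⟨-, hA2⟩ := abs_le.1 (abs_arg_negI_mul_le (z := z) hlow)
    obtain ⟨hB1, -⟩ := abs_le.1 (abs_arg_I_mul_le (z := z) (n := n) hlow)
    rw [hT] at hid
    linarith

/-- **Signed Umlaufsatz, right turn.** A simple closed polygon turning right (`extAngle z 0 < 0`)
at a lowest vertex `z 0` has total turning `−2π`. -/
theorem sum_extAngle_eq_neg_two_pi_of_lowest_of_neg (h : IsSimplePolygon z n)
    (hlow : ∀ i, (z 0).im ≤ (z i).im) (hneg : extAngle z 0 < 0) :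
    ∑ i ∈ Finset.range n, extAngle z i = -(2 * π) := by
  rcases h.sum_extAngle_eq_of_lowest hlow with hT | hT
  · exfalso
    have hid := sum_extAngle_eq_two_mul h hlow
    obtain ⟨hA1, -⟩ := abs_le.1 (abs_arg_negI_mul_le (z := z) hlow)
    obtain ⟨-, hB2⟩ := abs_le.1 (abs_arg_I_mul_le (z := z) (n := n) hlow)
    rw [hT] at hid
    linarith
  · exact hT

/-- Exterior angles of an `n`-periodic vertex sequence are `n`-periodic. -/
theorem extAngle_add_nat (hz : ∀ i, z (i + n) = z i) (i : ℤ) : extAngle z (i + n) = extAngle z i := by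
  unfold extAngle
  rw [show i + n + 1 = (i + 1) + n by ring, show i + n - 1 = (i - 1) + n by ring, hz, hz, hz]

/-- **Signed Umlaufsatz at an arbitrary lowest vertex, left turn**: if `z i₀` is a lowest vertex
of a simple closed polygon and the polygon turns left there, the exterior angles sum to `+2π`. -/
theorem sum_extAngle_eq_two_pi_of_isLowest_of_pos (h : IsSimplePolygon z n) {i₀ : ℕ}
    (hlow : ∀ i, (z i₀).im ≤ (z i).im) (hpos : 0 < extAngle z i₀) :
    ∑ i ∈ Finset.range n, extAngle z i = 2 * π := by
  set z' : ℤ → ℂ := fun i => z (i + i₀) with hz'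
  have h' : IsSimplePolygon z' n := h.shift i₀
  have hlow' : ∀ i, (z' 0).im ≤ (z' i).im := fun i => by simpa [hz'] using hlow (i + i₀)
  have hext : ∀ i : ℤ, extAngle z' i = extAngle z (i + i₀) := fun i => by
    simp only [extAngle, hz']
    rw [show i + 1 + (i₀ : ℤ) = i + i₀ + 1 by ring, show i - 1 + (i₀ : ℤ) = i + i₀ - 1 by ring]
  have hpos' : 0 < extAngle z' 0 := by rw [hext, zero_add]; exact hpos
  have hT := sum_extAngle_eq_two_pi_of_lowest_of_pos h' hlow' hpos'
  have hper : ∀ i, extAngle z (i + n) = extAngle z i := extAngle_add_nat (fun i => h.periodic i)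
  have hshift : ∑ i ∈ Finset.range n, extAngle z' i = ∑ i ∈ Finset.range n, extAngle z i := by
    rw [Finset.sum_congr rfl fun (i : ℕ) _ => hext i]
    exact sum_range_shift_of_periodic hper i₀
  rw [← hshift, hT]

/-- **Signed Umlaufsatz at an arbitrary lowest vertex, right turn.** -/
theorem sum_extAngle_eq_neg_two_pi_of_isLowest_of_neg (h : IsSimplePolygon z n) {i₀ : ℕ}
    (hlow : ∀ i, (z i₀).im ≤ (z i).im) (hneg : extAngle z i₀ < 0) :
    ∑ i ∈ Finset.range n, extAngle z i = -(2 * π) := by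
  set z' : ℤ → ℂ := fun i => z (i + i₀) with hz'
  have h' : IsSimplePolygon z' n := h.shift i₀
  have hlow' : ∀ i, (z' 0).im ≤ (z' i).im := fun i => by simpa [hz'] using hlow (i + i₀)
  have hext : ∀ i : ℤ, extAngle z' i = extAngle z (i + i₀) := fun i => by
    simp only [extAngle, hz']
    rw [show i + 1 + (i₀ : ℤ) = i + i₀ + 1 by ring, show i - 1 + (i₀ : ℤ) = i + i₀ - 1 by ring]
  have hneg' : extAngle z' 0 < 0 := by rw [hext, zero_add]; exact hneg
  have hT := sum_extAngle_eq_neg_two_pi_of_lowest_of_neg h' hlow' hneg'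
  have hper : ∀ i, extAngle z (i + n) = extAngle z i := extAngle_add_nat (fun i => h.periodic i)
  have hshift : ∑ i ∈ Finset.range n, extAngle z' i = ∑ i ∈ Finset.range n, extAngle z i := by
    rw [Finset.sum_congr rfl fun (i : ℕ) _ => hext i]
    exact sum_range_shift_of_periodic hper i₀
  rw [← hshift, hT]

/-- **Signed Hopf Umlaufsatz at a lowest vertex** (registered glue sub-goal `signedHopf_lowest` of the
line): for a simple closed polygon `z` of period `n` and a lowest vertex `z i₀`, a left turn there
(`extAngle z i₀ > 0`) gives total turning `+2π`, a right turn `−2π`. -/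
theorem signedHopf_lowest : ∀ (z : ℤ → ℂ) (n i₀ : ℕ), IsSimplePolygon z n →
    (∀ i, (z i₀).im ≤ (z i).im) →
      (0 < extAngle z i₀ → ∑ i ∈ Finset.range n, extAngle z i = 2 * Real.pi) ∧
      (extAngle z i₀ < 0 → ∑ i ∈ Finset.range n, extAngle z i = -(2 * Real.pi)) :=
  fun _ _ _ h hlow =>
    ⟨sum_extAngle_eq_two_pi_of_isLowest_of_pos h hlow, sum_extAngle_eq_neg_two_pi_of_isLowest_of_neg h hlow⟩

end Summit.CriticalPhenomena.CardyFormulaZ2.Cruxes.CoherentMorera.FinitaryGreenPairing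

end
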